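/-
Copyright (c) 2026 the pub-hodgecm-mathlib formalisation cell (harness21).  Prover seat hodgecm-mathlib-A-p19 (g27), 2026-09-02.  Road «S3-tree»∕«S3-ram» (LEAD F0P3a-plan (g12)
T11-41∕T11-52; owner p06 (g15)), row (e2) «P-2-ram», organ «(D2-β)-ram, part L: THE UNRAMIFIED QUADRATIC DICTIONARY AT A PLACE» — the twin of ★ F0P2-p06 (g11)'s [T2-L]
`RamifiedQuadraticDictionary` (p846635) with the uniformiser `d` replaced by a NON-SQUARE UNIT (the eigen-field of a type-(2) class at a tame-ramified base is UNRAMIFIED over `L_w`).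
-/
import Literature.NumberTheory.NumberFields.RamifiedQuadraticDictionary         -- ★ [T2-L] p846635: `toPlace_mem_integer_of_mem_integer`; brings ★ LQC Q1 `exists_ringEquiv_adjoinRoot_X_sq_sub_C`, ★ Q5 `existsUnique_eq_toPlace_add_toPlace_mul_of_sq_eq`, `valued_toPlace_add_toPlace_mul_of_unit`, `toPlace_add_toPlace_mul_mem_integer_iff_of_unit`, `ramificationIdx'_eq_one_of_isUnramifiedIn`, `valued_toPlace_of_ramificationIdx'_eq_one`
import Literature.NumberTheory.NumberFields.QuadraticUnramifiedAtUnitPlace        -- ★ LQC Q4-unit: `inertPlace_currency_of_sq_eq_unit`, `two_not_mem_iff_valued_two_eq_one`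
import HarnessLib

/-!
# The unramified quadratic dictionary at a place: `θ = √d` for a non-square UNIT `d`, the unramified coordinates of `K = E_w` over `F_v`, the two commuting isometric
# involutions `s̃ ∕ ι′` of `K`, and the `ι′`-anti-fixed elements

Topic `NumberTheory/NumberFields`; namespace `Literature.NumberTheory.NumberFields`.  THEOREMS ONLY (no definition, no instance, no notation, no named fact, no `sorry`); kernel lane
`--supports stmt-HodgeConjecture-24833`.  Cell `pub/hodgecm-mathlib` (D-0151), crux H413; road «S3-tree», seeding wave «S3-ram» (tame-ramified non-split `v ∤ 2`), row (e2) «P-2-ram»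
(the type-(2) share of `stub_levelOneRowsRam`; consumer A-p12 (g23) (α₂) STUB A₂); organ **«(D2-β)-ram, part L»** = the dictionary under the eigen-field package that discharges the
hypotheses `hcoord ∕ hanti ∕ σ ι` of ★ p847100 `RationalGoodVectorRamifiedBase` (CORE), ★ p847219 `RationalGoodVectorRamifiedBaseLaw` (LAW) and F0P3a-p08 (g19)'s (D5)-ram.  HONEST LABEL:
HC_CM is proved only modulo the 2 remaining named inputs (hLiu418 24832, h413 24833) until rung 0 closes; unconditional local algebra, count-neutral.

THE SETTING (★ [T2-L] with the uniformiser replaced by a unit).  `E ∕ F` a quadratic extension of number fields (`δ² = m₀` for an algebraic INTEGER `m₀`, `σ δ = −δ`, `δ ≠ 0`), `v` a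
finite place of `F` with `|2|_v = 1` and `m₀ ∉ 𝔭_v`, `d ∈ F_v` a NON-SQUARE UNIT (`|d|_v = 1`, `¬ IsSquare d`) with `d⁻¹ m₀ ∈ (F_v^×)²`; then `m₀` is a local non-square, `v` is INERT in `E`
(★ Q4-unit `inertPlace_currency_of_sq_eq_unit`: `σ ≠ 1`, `Algebra.IsUnramifiedIn`, `σ • w = w`), `e(w|v) = 1` (★ Q5), and `K := E_w = F_v(√d)` (★ Q1).  Writing `ι₁ := toPlace v w`:
* (L1′) **`exists_sqrt_and_coord_of_unit`** — `∃ θ ∈ K`, `θ² = ι₁ d`, `|θ|_w = 1`, every `z` is uniquely `ι₁ p + ι₁ q θ` (★ Q5 §3), `ι₁ p + ι₁ q θ ∈ 𝒪[K] ↔ p, q ∈ 𝒪[F_v]`, and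
  `|ι₁ p + ι₁ q θ|_w = max (|p|_v, |q|_v)` (★ Q5 §4 — the UNRAMIFIED integral basis `(1, θ)`);
* (L2′) **`exists_involutions_of_unit`** — an involution `s` of `F_v` with `s d = d`, `s 𝒪 ⊆ 𝒪`, `|s x| = |x|` extends to `s̃ : K →+* K` over `s` with `s̃ θ = θ`, and the `F_v`-linear
  involution `ι′` has `ι′ θ = −θ`; both are involutive, `𝒪`-stable, ISOMETRIC, and they COMMUTE (everything read in the coordinates of (L1′)) — in the application `s = σ_w` (the CM
  involution of `L_w` at a RAMIFIED `w`, fixing the non-square-residue constant `d = η₀ ∈ L⁺_v`), `s̃` is the torus-type-A CM involution of the eigen-field `M = L_w(√η₀)`, `s̃ ∘ ι′`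
  the type-B one, `ι′` the `L_w`-involution;
* (L3′) **`exists_eq_toPlace_mul_of_map_eq_neg`** — an `ι′`-ANTI-fixed `z` is `ι₁ q · θ` (`2 ≠ 0`): the `hanti` binder of ★ p847219; and `map_eq_self_iff_exists_eq_toPlace` — `ι′ z = z ↔ z ∈ ι₁(F_v)`.

* §0 `not_isSquare_coe_of_isSquare_inv_mul`, `ramificationIdx'_eq_one_of_unit`, (private) `exists_ringEquiv_adjoinRoot_of_sq_eq_unit` (same conclusion as ★ [T2-L]'s, hypothesis `hns` instead of a uniformiser).  §1 (L1′).  §2 (L2′).  §3 (L3′).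

## References
* [SerreLocalFields1979] J.-P. Serre, *Local Fields*, GTM 67 (1979): Ch. I §6 Prop. 16 (unramified extensions: integral basis from a residual generator), Ch. III §5.
* [Neukirch1999] J. Neukirch, *Algebraic Number Theory*, Grundlehren 322 (1999): Ch. II §7 (unramified extensions), (8.2)–(8.3) (completions of a global extension).
* [Lang2002] S. Lang, *Algebra*, GTM 211 (2002): Ch. V §1 (the universal property of `K[X]⁄(f)`).
-/

set_option autoImplicit false

noncomputable section

open NumberField IsDedekindDomain Polynomial
open scoped ValuativeRel
open Literature.NumberTheory.Automorphic Literature.NumberTheory.Automorphic.UnitaryGroup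

namespace Literature.NumberTheory.NumberFields

variable {F : Type} (E : Type) [Field F] [NumberField F] [Field E] [NumberField E] [Algebra F E] [Algebra.IsQuadraticExtension F E]
  (v : HeightOneSpectrum (𝓞 F)) (σ : E ≃ₐ[F] E) {δ : E} (hσδ : σ δ = -δ) (hδ : δ ≠ 0) (m₀ : 𝓞 F) (hm : algebraMap F E m₀ = δ ^ 2) (hm₀ : m₀ ∉ v.asIdeal)
  {d : v.adicCompletion F} (hd : Valued.v d = 1) (hns : ¬ IsSquare d) (hdm : IsSquare (d⁻¹ * (((m₀ : F)) : v.adicCompletion F)))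
  (h2 : Valued.v (2 : v.adicCompletion F) = 1) (w : PlacesOver E v)

/-! ## §0 Preliminaries: `m₀` is a local non-square; `e(w|v) = 1`; the isomorphism `F_v[X]⁄(X² − d) ≃ E_w` through a GIVEN square root -/

include hns hdm hm₀ in
omit [NumberField E] [Algebra F E] [Algebra.IsQuadraticExtension F E] in
/-- If `d` is a non-square, `d⁻¹ m₀` a square and `m₀ ∉ 𝔭_v` then `m₀` is a non-square in `F_v`. [cite: SerreLocalFields1979, Ch. I §6] -/
theorem not_isSquare_coe_of_isSquare_inv_mul : ¬ IsSquare (((m₀ : F)) : v.adicCompletion F) := by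
  rintro ⟨s, hs⟩
  obtain ⟨r, hr⟩ := hdm
  have hd0 : d ≠ 0 := by rintro rfl; exact hns ⟨0, by simp⟩
  have hm0 : (((m₀ : F)) : v.adicCompletion F) ≠ 0 := by
    intro h0
    have h := (valued_coe_eq_one_iff_not_mem v m₀).2 hm₀
    rw [h0, map_zero] at h
    exact zero_ne_one h
  have hr0 : r ≠ 0 := by
    rintro rfl
    rw [mul_zero, mul_eq_zero] at hr
    exact hr.elim (inv_ne_zero hd0) hm0
  apply hns
  refine ⟨s / r, ?_⟩
  have h1 : (((m₀ : F)) : v.adicCompletion F) = d * (r * r) := by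
    rw [← hr, ← mul_assoc, mul_inv_cancel₀ hd0, one_mul]
  field_simp
  rw [pow_two, pow_two, ← hs]
  exact h1.symm

include hσδ hδ hm hm₀ hns hdm h2 in
/-- **`e(w|v) = 1`**: `v` is unramified in `E = F(√m₀)` (`m₀` a `v`-unit, `v ∤ 2`; ★ Q4-unit `inertPlace_currency_of_sq_eq_unit` + ★ Q5 `ramificationIdx'_eq_one_of_isUnramifiedIn`).
[cite: Neukirch1999, Ch. II §7] -/
theorem ramificationIdx'_eq_one_of_unit : v.asIdeal.ramificationIdx' w.1.asIdeal = 1 := by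
  have h2' : (2 : 𝓞 F) ∉ v.asIdeal := (two_not_mem_iff_valued_two_eq_one v).2 h2
  obtain ⟨-, hv, -⟩ := inertPlace_currency_of_sq_eq_unit E v σ hσδ hδ m₀ hm hm₀ h2' (not_isSquare_coe_of_isSquare_inv_mul v m₀ hm₀ hns hdm) w
  exact ramificationIdx'_eq_one_of_isUnramifiedIn E v w hv

include hσδ hδ hm hns hdm in
/-- **`F_v[X]⁄(X² − d) ≃ E_w` THROUGH A GIVEN SQUARE ROOT** (unit case): for ANY `θ ∈ E_w` with `θ² = ι₁ d` the lift `AdjoinRoot.lift ι₁ θ` is a ring isomorphism `e` with `e ∘ of = ι₁`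
and `e(root) = θ` (★ [T2-L]'s argument: injective as `X² − d` is irreducible, surjective by the coordinates ★ Q5 §3). [cite: Lang2002, Ch. V §1] [cite: Neukirch1999, Ch. II (8.2)–(8.3)] -/
private theorem exists_ringEquiv_adjoinRoot_of_sq_eq_unit {θ : w.1.adicCompletion E} (hθ : θ ^ 2 = toPlace v w d) :
    ∃ e : AdjoinRoot (X ^ 2 - C d) ≃+* w.1.adicCompletion E,
      (∀ a : v.adicCompletion F, e (AdjoinRoot.of (X ^ 2 - C d) a) = toPlace v w a) ∧ e (AdjoinRoot.root (X ^ 2 - C d)) = θ := by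
  have hroot : (X ^ 2 - C d).eval₂ (toPlace v w) θ = 0 := by
    rw [eval₂_sub, eval₂_X_pow, eval₂_C, hθ, sub_self]
  let φ : AdjoinRoot (X ^ 2 - C d) →+* w.1.adicCompletion E := AdjoinRoot.lift (toPlace v w) θ hroot
  haveI : Fact (Irreducible (X ^ 2 - C d)) := ⟨irreducible_X_sq_sub_C_of_not_isSquare d hns⟩
  have hinj : Function.Injective φ := φ.injective
  have hsurj : Function.Surjective φ := by
    intro z
    obtain ⟨pq, hpq, -⟩ := existsUnique_eq_toPlace_add_toPlace_mul_of_sq_eq E v σ hσδ hδ hm hns hdm w hθ z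
    refine ⟨AdjoinRoot.of _ pq.1 + AdjoinRoot.of _ pq.2 * AdjoinRoot.root _, ?_⟩
    rw [map_add, map_mul, AdjoinRoot.lift_of, AdjoinRoot.lift_of, AdjoinRoot.lift_root, hpq]
  refine ⟨RingEquiv.ofBijective φ ⟨hinj, hsurj⟩, fun a => ?_, ?_⟩
  · exact AdjoinRoot.lift_of hroot
  · exact AdjoinRoot.lift_root hroot

/-! ## §1 (L1′) `θ = √d` and the unramified coordinates of `K = E_w` over `F_v` -/

include hσδ hδ hm hm₀ hd hns hdm h2 in
/-- **(L1′) `θ = √d` AND THE UNRAMIFIED COORDINATES OF `K = E_w` OVER `F_v`**: `θ² = ι₁ d`, `|θ| = 1`, unique coordinates `z = ι₁ p + ι₁ q θ`, integrality iff `p, q` integral, and the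
valuation formula `|ι₁ p + ι₁ q θ| = max(|p|, |q|)`. [cite: SerreLocalFields1979, Ch. I §6 Prop. 16] [cite: Neukirch1999, Ch. II §7, (8.2)–(8.3)] -/
theorem exists_sqrt_and_coord_of_unit :
    ∃ θ : w.1.adicCompletion E, θ ^ 2 = toPlace v w d ∧ Valued.v θ = 1 ∧
      (∀ z : w.1.adicCompletion E, ∃! pq : v.adicCompletion F × v.adicCompletion F, z = toPlace v w pq.1 + toPlace v w pq.2 * θ) ∧
      (∀ p q : v.adicCompletion F, toPlace v w p + toPlace v w q * θ ∈ 𝒪[w.1.adicCompletion E] ↔ p ∈ 𝒪[v.adicCompletion F] ∧ q ∈ 𝒪[v.adicCompletion F]) ∧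
      (∀ p q : v.adicCompletion F, Valued.v (toPlace v w p + toPlace v w q * θ) = max (Valued.v p) (Valued.v q)) := by
  have he : v.asIdeal.ramificationIdx' w.1.asIdeal = 1 := ramificationIdx'_eq_one_of_unit E v σ hσδ hδ m₀ hm hm₀ hns hdm h2 w
  obtain ⟨e, -, he_root⟩ := exists_ringEquiv_adjoinRoot_X_sq_sub_C E v σ hσδ hδ hm hns hdm w
  have hval : ∀ p q : v.adicCompletion F, Valued.v (toPlace v w p + toPlace v w q * e (AdjoinRoot.root (X ^ 2 - C d))) = max (Valued.v p) (Valued.v q) :=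
    valued_toPlace_add_toPlace_mul_of_unit E v w he h2 hd hns he_root
  have hθv : Valued.v (e (AdjoinRoot.root (X ^ 2 - C d))) = 1 := by
    have h := hval 0 1
    rwa [map_zero, map_one, zero_add, one_mul, map_zero, map_one, max_eq_right zero_le] at h
  refine ⟨e (AdjoinRoot.root (X ^ 2 - C d)), he_root, hθv,
    fun z => existsUnique_eq_toPlace_add_toPlace_mul_of_sq_eq E v σ hσδ hδ hm hns hdm w he_root z, fun p q => ?_, hval⟩
  rw [toPlace_add_toPlace_mul_mem_integer_iff_of_unit E v w he h2 hd hns he_root, mem_integer_iff_valued_le_one, mem_integer_iff_valued_le_one]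

/-! ## §2 (L2′) The two commuting isometric involutions of `K = F_v(θ)` -/

include hσδ hδ hm hm₀ hd hns hdm h2 in
/-- **(L2′) THE TWO INVOLUTIONS OF `K = F_v(θ)`, unit case**: an ISOMETRIC involution `s` of `F_v` fixing `d` and preserving `𝒪` extends to `s̃ : K →+* K` with `s̃ θ = θ`
(`AdjoinRoot.lift (ι₁ ∘ s) θ` through §0's `e`), and the `F_v`-linear `ι′` has `ι′ θ = −θ`; both are involutive, `𝒪`-stable and ISOMETRIC (`|s̃ z| = |z|`, `|ι′ z| = |z|`, read in the
coordinates of (L1′): `|ι₁ p + ι₁ q θ| = max(|p|, |q|)`), and `s̃ ∘ ι′ = ι′ ∘ s̃`. [cite: Lang2002, Ch. V §1] [cite: SerreLocalFields1979, Ch. I §6 Prop. 16] [cite: Neukirch1999, Ch. II §7] -/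
theorem exists_involutions_of_unit (s : v.adicCompletion F →+* v.adicCompletion F) (hss : ∀ x, s (s x) = x) (hsd : s d = d)
    (hsO : ∀ x : 𝒪[v.adicCompletion F], s x ∈ 𝒪[v.adicCompletion F]) (hsv : ∀ x, Valued.v (s x) = Valued.v x)
    {θ : w.1.adicCompletion E} (hθ : θ ^ 2 = toPlace v w d) :
    ∃ s' ι' : w.1.adicCompletion E →+* w.1.adicCompletion E,
      ((∀ x, s' (toPlace v w x) = toPlace v w (s x)) ∧ s' θ = θ ∧ (∀ z, s' (s' z) = z) ∧
        (∀ z : 𝒪[w.1.adicCompletion E], s' z ∈ 𝒪[w.1.adicCompletion E]) ∧ (∀ z, Valued.v (s' z) = Valued.v z)) ∧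
      ((∀ x, ι' (toPlace v w x) = toPlace v w x) ∧ ι' θ = -θ ∧ (∀ z, ι' (ι' z) = z) ∧
        (∀ z : 𝒪[w.1.adicCompletion E], ι' z ∈ 𝒪[w.1.adicCompletion E]) ∧ (∀ z, Valued.v (ι' z) = Valued.v z)) ∧
      (∀ z, s' (ι' z) = ι' (s' z)) := by
  have he : v.asIdeal.ramificationIdx' w.1.asIdeal = 1 := ramificationIdx'_eq_one_of_unit E v σ hσδ hδ m₀ hm hm₀ hns hdm h2 w
  set ι := toPlace v w with hιdef
  -- coordinates, integrality and valuations in the unramified basis `(1, θ)`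
  have hcoord : ∀ z : w.1.adicCompletion E, ∃ pq : v.adicCompletion F × v.adicCompletion F, z = ι pq.1 + ι pq.2 * θ := fun z =>
    (existsUnique_eq_toPlace_add_toPlace_mul_of_sq_eq E v σ hσδ hδ hm hns hdm w hθ z).exists
  have hint : ∀ p q : v.adicCompletion F, ι p + ι q * θ ∈ 𝒪[w.1.adicCompletion E] ↔ p ∈ 𝒪[v.adicCompletion F] ∧ q ∈ 𝒪[v.adicCompletion F] := by
    intro p q
    rw [hιdef, toPlace_add_toPlace_mul_mem_integer_iff_of_unit E v w he h2 hd hns hθ, mem_integer_iff_valued_le_one, mem_integer_iff_valued_le_one]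
  have hval : ∀ p q : v.adicCompletion F, Valued.v (ι p + ι q * θ) = max (Valued.v p) (Valued.v q) :=
    valued_toPlace_add_toPlace_mul_of_unit E v w he h2 hd hns hθ
  -- the isomorphism `e : F_v[X]⁄(X² − d) ≃ E_w` through `θ`
  obtain ⟨e, he_of, he_root⟩ := exists_ringEquiv_adjoinRoot_of_sq_eq_unit E v σ hσδ hδ m₀ hm hns hdm w hθ
  have hsymm_of : ∀ x, e.symm (ι x) = AdjoinRoot.of (X ^ 2 - C d) x := fun x => by
    rw [hιdef, ← he_of, RingEquiv.symm_apply_apply]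
  have hsymm_root : e.symm θ = AdjoinRoot.root (X ^ 2 - C d) := by rw [← he_root, RingEquiv.symm_apply_apply]
  -- `s̃ := lift (ι ∘ s) θ ∘ e⁻¹`
  have hroot_s : (X ^ 2 - C d).eval₂ (ι.comp s) θ = 0 := by
    rw [eval₂_sub, eval₂_X_pow, eval₂_C, RingHom.comp_apply, hsd, hθ, hιdef, sub_self]
  let ψs : AdjoinRoot (X ^ 2 - C d) →+* w.1.adicCompletion E := AdjoinRoot.lift (ι.comp s) θ hroot_s
  let s' : w.1.adicCompletion E →+* w.1.adicCompletion E := ψs.comp e.symm.toRingHom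
  have hs'ι : ∀ x, s' (ι x) = ι (s x) := fun x => by
    change ψs (e.symm (ι x)) = ι (s x)
    rw [hsymm_of, AdjoinRoot.lift_of, RingHom.comp_apply]
  have hs'θ : s' θ = θ := by
    change ψs (e.symm θ) = θ
    rw [hsymm_root, AdjoinRoot.lift_root]
  have hs'pq : ∀ p q : v.adicCompletion F, s' (ι p + ι q * θ) = ι (s p) + ι (s q) * θ := fun p q => by
    rw [map_add, map_mul, hs'ι, hs'ι, hs'θ]
  -- `ι′ := lift ι (−θ) ∘ e⁻¹`
  have hroot_i : (X ^ 2 - C d).eval₂ ι (-θ) = 0 := by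
    rw [eval₂_sub, eval₂_X_pow, eval₂_C, neg_sq, hθ, hιdef, sub_self]
  let ψi : AdjoinRoot (X ^ 2 - C d) →+* w.1.adicCompletion E := AdjoinRoot.lift ι (-θ) hroot_i
  let ι' : w.1.adicCompletion E →+* w.1.adicCompletion E := ψi.comp e.symm.toRingHom
  have hι'ι : ∀ x, ι' (ι x) = ι x := fun x => by
    change ψi (e.symm (ι x)) = ι x
    rw [hsymm_of, AdjoinRoot.lift_of]
  have hι'θ : ι' θ = -θ := by
    change ψi (e.symm θ) = -θ
    rw [hsymm_root, AdjoinRoot.lift_root]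
  have hι'pq : ∀ p q : v.adicCompletion F, ι' (ι p + ι q * θ) = ι p + ι (-q) * θ := fun p q => by
    rw [map_add, map_mul, hι'ι, hι'ι, hι'θ, map_neg]; ring
  refine ⟨s', ι', ⟨fun x => hs'ι x, hs'θ, fun z => ?_, fun z => ?_, fun z => ?_⟩, ⟨fun x => hι'ι x, hι'θ, fun z => ?_, fun z => ?_, fun z => ?_⟩, fun z => ?_⟩
  · obtain ⟨pq, rfl⟩ := hcoord z
    rw [hs'pq, hs'pq, hss, hss]
  · obtain ⟨pq, hpq⟩ := hcoord z
    have hmem := z.2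
    rw [hpq, hint] at hmem
    change s' (z : w.1.adicCompletion E) ∈ 𝒪[w.1.adicCompletion E]
    rw [hpq, hs'pq, hint]
    exact ⟨hsO ⟨pq.1, hmem.1⟩, hsO ⟨pq.2, hmem.2⟩⟩
  · obtain ⟨pq, rfl⟩ := hcoord z
    rw [hs'pq, hval, hval, hsv, hsv]
  · obtain ⟨pq, rfl⟩ := hcoord z
    rw [hι'pq, hι'pq, neg_neg]
  · obtain ⟨pq, hpq⟩ := hcoord z
    have hmem := z.2
    rw [hpq, hint] at hmem
    change ι' (z : w.1.adicCompletion E) ∈ 𝒪[w.1.adicCompletion E]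
    rw [hpq, hι'pq, hint]
    exact ⟨hmem.1, neg_mem hmem.2⟩
  · obtain ⟨pq, rfl⟩ := hcoord z
    rw [hι'pq, hval, hval, Valuation.map_neg]
  · obtain ⟨pq, rfl⟩ := hcoord z
    rw [hι'pq, hs'pq, hs'pq, hι'pq, map_neg]

/-! ## §3 (L3′) The `ι′`-anti-fixed elements are the rational multiples of `θ` -/

include hσδ hδ hm hns hdm h2 in
/-- **(L3′) `ι′ z = −z ⇒ z = ι₁ q · θ`** — an `ι′`-anti-fixed element has vanishing rational coordinate (`2 ≠ 0`): the `hanti` binder of ★ `RationalGoodVectorRamifiedBaseLaw`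
(with `b := ι₁ q`, `ι′ b = b`). [cite: SerreLocalFields1979, Ch. I §6] [cite: Neukirch1999, Ch. II §7] -/
theorem exists_eq_toPlace_mul_of_map_eq_neg {θ : w.1.adicCompletion E} (hθ : θ ^ 2 = toPlace v w d)
    (ι' : w.1.adicCompletion E →+* w.1.adicCompletion E) (hι'ι : ∀ x, ι' (toPlace v w x) = toPlace v w x) (hι'θ : ι' θ = -θ)
    {z : w.1.adicCompletion E} (hz : ι' z = -z) :
    ∃ q : v.adicCompletion F, z = toPlace v w q * θ := by
  obtain ⟨pq, hpq, -⟩ := existsUnique_eq_toPlace_add_toPlace_mul_of_sq_eq E v σ hσδ hδ hm hns hdm w hθ z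
  have h2K : (2 : w.1.adicCompletion E) ≠ 0 := by
    have h : Valued.v (toPlace v w 2) = Valued.v (2 : v.adicCompletion F) ^ v.asIdeal.ramificationIdx' w.1.asIdeal := valued_toPlace (E := E) v w 2
    rw [map_ofNat, h2, one_pow] at h
    intro h0
    rw [h0, map_zero] at h
    exact zero_ne_one h
  have h := hz
  rw [hpq, map_add, map_mul, hι'ι, hι'ι, hι'θ, neg_add, mul_neg] at h
  -- `ι₁ p = −ι₁ p`, so `ι₁ p = 0`
  have hp : toPlace v w pq.1 = 0 := by
    have h2p : (2 : w.1.adicCompletion E) * toPlace v w pq.1 = 0 := by linear_combination h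
    exact (mul_eq_zero.1 h2p).resolve_left h2K
  exact ⟨pq.2, by rw [hpq, hp, zero_add]⟩

include hσδ hδ hm hns hdm h2 in
/-- **`Fix ι′ = ι₁(F_v)`**: `ι′ z = z ↔ ∃ x, ι₁ x = z` (the `hιj` binder of the ★ seam ∕ ★ `RationalCyclicSelfDualLatticesOfLocus`). [cite: SerreLocalFields1979, Ch. I §6] -/
theorem map_eq_self_iff_exists_eq_toPlace {θ : w.1.adicCompletion E} (hθ : θ ^ 2 = toPlace v w d) (hθ0 : θ ≠ 0)
    (ι' : w.1.adicCompletion E →+* w.1.adicCompletion E) (hι'ι : ∀ x, ι' (toPlace v w x) = toPlace v w x) (hι'θ : ι' θ = -θ)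
    (z : w.1.adicCompletion E) :
    ι' z = z ↔ ∃ x, toPlace v w x = z := by
  refine ⟨fun hz => ?_, ?_⟩
  · obtain ⟨pq, hpq, -⟩ := existsUnique_eq_toPlace_add_toPlace_mul_of_sq_eq E v σ hσδ hδ hm hns hdm w hθ z
    have h2K : (2 : w.1.adicCompletion E) ≠ 0 := by
      have h : Valued.v (toPlace v w 2) = Valued.v (2 : v.adicCompletion F) ^ v.asIdeal.ramificationIdx' w.1.asIdeal := valued_toPlace (E := E) v w 2
      rw [map_ofNat, h2, one_pow] at h
      intro h0
      rw [h0, map_zero] at h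
      exact zero_ne_one h
    have h := hz
    rw [hpq, map_add, map_mul, hι'ι, hι'ι, hι'θ] at h
    have h2q : (2 : w.1.adicCompletion E) * (toPlace v w pq.2 * θ) = 0 := by linear_combination -h
    have hq0 : toPlace v w pq.2 = 0 := (mul_eq_zero.1 ((mul_eq_zero.1 h2q).resolve_left h2K)).resolve_right hθ0
    exact ⟨pq.1, by rw [hpq, hq0, zero_mul, add_zero]⟩
  · rintro ⟨x, rfl⟩
    exact hι'ι x

end Literature.NumberTheory.NumberFields

end
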